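import Summits.QuantumFields.BalabanUV.T4Continuum.Support.T4TrajectoryDensityGated

/-!
# T⁴ programme, spine estimate NE1′ (node O3b/H2) — THE NAMED ROW ROOT IN THE DRESSED FORMAT (owner's answer to Q-root-1 ∕
# GAPS-T4 G-t4r2-116), its END faces BY NAME, the K- and μ-UNIFORM packaging, and non-vacuity

Cell `pub-balaban`, sub-cell `t4`, BINDER-OWNERS row NE1′; owner lineage t4-ne1p-p1 (PROVER seat P1, technique «RG-trajectory
comparison»), generation 23; tree target `Summits/QuantumFields/BalabanUV/T4Continuum/Spine/NE1p/`; ADDITIVE — imports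
`Support/T4TrajectoryDensityGated` ONLY, modifies nothing.

WHY THIS FILE.  The referee's node test of row NE1′ (t4-ref2 passes 58–61, GAPS-T4 C-t4r2-302, C-t4r2-304, G-t4r2-116) needs a NAMED
root: «a `def`/END conclusion typed by the owner or the carver».  The row text (BINDER-OWNERS l.10, RULING R-t4r2-Q2 ∕ C-t4r2-267)
is: NE1′ = DRESSED STABILITY OF THE OBSERVABLE-ATTACHED TERMS — `(ℝ𝕋)^K` applied to `ρ₀·f_μ` keeps the (2.18)-type representation
extended by observable-attached terms, with constants UNIFORM in the cutoff `K` and in the source `μ` on a window `|μ| ≤ μ₀`.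
In the cell's typed currency (the hierarchical booking `T4TermFormat.Booking` of T4-REF-O3 V4 and the booked trajectory
`T4TrajectoryComparison.Trajectory` of this lineage) that statement is, per cutoff, a SIZE CLASS of the booked observable-attached
terms of two-rate form `σ j k = A₀·ρ₁^{k−j}·τ^{K−j}` — hence, with positional counts, the per-cube budget (TOB-k) — and the
content of «uniform» is the ORDER OF QUANTIFIERS: the constants are chosen BEFORE the cutoff and the run parameter.  This file
gives that statement ONE NAME and wires it to the lineage's landed END.

* §1 `twoRate A₀ ρ₁ τ K` [shape] — the uniform class; `twoRate_succ` (`σ j (k+1) = ρ₁·σ j k`), `twoRate_nonneg`.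
* §2 `DressedTower P` [data] — the dressed run BOOKED AT EVERY CUTOFF and every run parameter `p : P` (the instantiation takes
  `P` = tuned bare-coupling sequences × loop strings × the source window `{μ : |μ| ≤ μ₀}`; `B p K` = the booking of the
  observable-attached terms of `(ℝ′𝕋)^k(ρ₀·f_μ)`, `k ≤ K`, node H2 + row O3.E-i′ — NOT constructed in the tree; nothing of
  Bałaban's densities is asserted here).  `ClassAt` [shape] — the class at one cutoff.  **`DressedStability 𝒯`** [shape] — THE ROW
  ROOT: `∃ A₀ ρ₁ τ ≥ 0, τ ≤ 1, ∀ p K, (𝒯.B p K).SizeBound (twoRate A₀ ρ₁ τ K)`.  `cubeBudget_of_dressedStability` [bookkeeping]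
  — with K-free positional counts `N₀Λ^{k−j}` and `Λρ₁τ ≤ 1` the root gives the budget `(N₀A₀)·W` at EVERY cube of EVERY cutoff
  (`T4TermFormat.Booking.cubeBudget_of_twoRate` by name): the (TOB-k) smallness the (2.18)-type consumers (rows O3.E-iii-c, U5b.E,
  O4) quantify over.
* §3 END-B (booking level) [bookkeeping]: `UniformConstants` — the K- and μ-FREE numbers `(C, A₀, ρ₁, τ, Λ, N₀, ρ′, s̄⁰, m)` with
  their sign ∕ strictness constraints, the strict product `Λρ₁τ ≤ ρ′ < 1` ((w7)) and the smallness `m·N₀A₀(1−ρ′)⁻¹ ≤ 1 − s̄⁰`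
  ((w6)); `BookingLeaves U Bk` — the per-cutoff trajectory data (rates `ρ`, regeneration constants `c`, action margins `s⁰`,
  live-family finsets `S`) with the LEAF BINDERS of `T4TrajectoryDensityDressed.dressedBudget_closed` labelled by wall item:
  (w1)+(w5b) `hbirth : BirthsFromOld`, (w5)∕O-G2 `hreg : RegeneratesFromVar`, T `htr : TransportsFromVar` (the transport leaf —
  discharged at FUNCTION level by END-F below), (w7) `hrate : ρ k + C·c k ≤ ρ₁`, (w3-book) `hS`/`hcount`, (w2-act) `hs₀ : s⁰ ≤ s̄⁰`;
  `classAt_of_bookingLeaves` (one cutoff: `dressedBudget_closed` ⟹ envelope bound ⟹ `SizeBoundAt` ⟹ the class, plus every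
  dressed budget gate) and **`dressedStability_of_bookingLeaves`**: leaves with the SAME `U` at every `(p, K)` ⟹ `DressedStability`.
* §4 END-F (function level) BY NAME [bookkeeping]: `transportLeaf_of_centredExponent` — the transport leaf `htr` with
  `Gate := budgetGate …` IS the conclusion of the lineage's gated per-family capstone
  `transportsFromVar_of_centredExponent_lattice_fam_gated` with its budget binder `hs` DISCHARGED by `hs_of_budgetGate`; the
  remaining displayed binders are the wall of record `t4/T4-EST-NE1p-P1.md` §4: (w1) `hsl` births, H2 `hFn` step law, (w2-act)
  `hB`/`hE`, `hP` (discharged under the history by `T4TrajectoryDensityAssembly.pertSlice_under_history`), (w3)⁺ `hN1`/`hN2`/`hdiam`/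
  `hθ`, (w4) `hdom`, (I4′) `hrate`/`hdefw`, attainment `hlin`, invariance/measurability `hinv`/`h𝒢`.
* NON-VACUITY is the sibling leaf `Spine/NE1p/DressedRootWitness.lean` [decided toy]: a one-family geometric tower whose leaf
  binders `BookingLeaves U` hold at EVERY cutoff with ONE K-free `U`, the root obtained THROUGH END-B, positive sizes.
  `sizeBound_of_dressedStabilityWith` (§2) is the consumer face (the root unfolds to `Booking.SizeBound`).

HONEST FRAMING.  Rung (B)+1 bookkeeping on ONE finite four-torus of fixed physical size — NOT infinite volume, NOT a mass gap, NOT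
the Clay problem, NOT summit progress.  NE1′ is NOT PRINTED ([Balaban1989LargeFieldII] (1.73)–(1.75) pp. 379–380 type the ACTION's
representation only; p. 356 defers observables) and NOT PROVED: every headline here reads «root ⇐ the named binders», and 0 of the
binders is instantiated on Bałaban's densities (the wall (w1), (w2-act), (w3)⁺, (w4)–(w7) of the record).  [folklore] kernel glue,
0 sorry, 0 citations used as hypothesis-free facts.  Spine PROVED 0∕9 unchanged.  HONEST DEPENDENCY: continuum YM on T⁴ ⇐
BetaPertH ∧ nine spine estimates (0/9 proved); BetaPertH ⇐ (D1) ∧ (D4) ∧ CAP+tail; G-an2-4 gates asym, D1 and NE2/3/4.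

RELATION TO THE CO-OWNER ROADS (record, not kernel): road P4's μ-FREE `T4ExteriorCovariance.UniformCovDefect D g₀` (typed on the
datum `D`, reaching `HasContinuumLimit` with `MidLimits`, `CovariantMeanContraction.hasContinuumLimit_of_factorisedCovSupply_midLimits`)
is the telescoping lane's ALTERNATIVE READING (T4-DAG §6 (1d)); roads P2/P3 are SUPPLIERS of the transport leaf T (response
moduli ∕ displacement transport per step).  Which of the two typed roots is the row's root OF RECORD is the carver's ruling
(G-t4r2-116 (a)/(b)); this file supplies candidate (b) so that both are in the tree.
-/

noncomputable section

namespace Summit.QuantumFields.BalabanUV.T4Continuum.NE1p.DressedRoot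

open Finset
open scoped BigOperators
open Literature.MathematicalPhysics.QuantumFieldTheory.Balaban1983to89
open Literature.MathematicalPhysics.QuantumFieldTheory.Balaban1983to89.T4TermFormat
open Literature.MathematicalPhysics.QuantumFieldTheory.Balaban1983to89.T4TermFormat.Booking
open Literature.MathematicalPhysics.QuantumFieldTheory.Balaban1983to89.T4GatedBooking
open Literature.MathematicalPhysics.QuantumFieldTheory.Balaban1983to89.T4TrajectoryComparison
open Summit.QuantumFields.BalabanUV.T4Continuum.T4TrajectoryDensityDressed

/-! ## §1 The uniform two-rate class -/

/-- **THE UNIFORM CLASS** [shape]: `σ j k = A₀·ρ₁^{k−j}·τ^{K−j}` — amplitude `A₀` (∝ the source strength `|μ|` times the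
transport constant), per-step family factor `ρ₁` (transport rate + regeneration), source decay `τ` from the birth scale to the
unit lattice (cell reading: `τ = θ₁ = L⁻³`, `ρ₁ ≳ e³ψ`, `ψ = L⁻²`; NOT asserted). [folklore] -/
def twoRate (A₀ ρ₁ τ : ℝ) (K : ℕ) : ℕ → ℕ → ℝ := fun j k => A₀ * ρ₁ ^ (k - j) * τ ^ (K - j)

/-- The class is nonnegative for nonnegative constants. [folklore] -/
theorem twoRate_nonneg {A₀ ρ₁ τ : ℝ} (hA₀ : 0 ≤ A₀) (hρ₁ : 0 ≤ ρ₁) (hτ : 0 ≤ τ) (K j k : ℕ) :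
    0 ≤ twoRate A₀ ρ₁ τ K j k := by
  unfold twoRate; positivity

/-- One step multiplies the class by `ρ₁`: `σ j (k+1) = ρ₁·σ j k` for `j ≤ k`. [arith] [folklore] -/
theorem twoRate_succ (A₀ ρ₁ τ : ℝ) (K : ℕ) {j k : ℕ} (hjk : j ≤ k) :
    twoRate A₀ ρ₁ τ K j (k + 1) = ρ₁ * twoRate A₀ ρ₁ τ K j k := by
  unfold twoRate
  rw [Nat.succ_sub hjk, pow_succ]
  ring

/-- Class compatibility of the cumulative induction from a K-free bound on the family factor: `ρ k + C·c k ≤ ρ₁` gives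
`(ρ k + C·c k)·σ j k ≤ σ j (k+1)`. [arith] [folklore] -/
theorem twoRate_compat {A₀ ρ₁ τ C : ℝ} {ρ c : ℕ → ℝ} (hA₀ : 0 ≤ A₀) (hρ₁ : 0 ≤ ρ₁) (hτ : 0 ≤ τ) (K : ℕ)
    (h : ∀ k, k < K → ρ k + C * c k ≤ ρ₁) :
    ∀ j k, j ≤ k → k < K → (ρ k + C * c k) * twoRate A₀ ρ₁ τ K j k ≤ twoRate A₀ ρ₁ τ K j (k + 1) := by
  intro j k hjk hk
  rw [twoRate_succ A₀ ρ₁ τ K hjk]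
  exact mul_le_mul_of_nonneg_right (h k hk) (twoRate_nonneg hA₀ hρ₁ hτ K j k)

/-! ## §2 The dressed tower, the root, and the budget corollary -/

/-- **DATA — THE DRESSED RUN BOOKED AT EVERY CUTOFF** [data]: for every run parameter `p : P` and every cutoff `K`, a booking
`B p K` with `(B p K).K = K` and a booked trajectory over it.  The instantiation (node H2 + row O3.E-i′; NOT in the tree) takes
`P` = (tuned bare-coupling sequence, loop string, source `μ` in the window) and `B p K` = the hierarchical booking of the
observable-attached terms generated by `(ℝ′𝕋)^k` on `ρ₀·f_μ`, `k ≤ K`, with `size b k` the booked sup-size of the term `b` at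
scale `k` and `T p K` its generation ∕ re-linearisation data.  Data only; NOTHING about Bałaban's densities is asserted. [folklore] -/
structure DressedTower (P : Type*) where
  /-- the booking of the dressed run with parameter `p` at cutoff `K` -/
  B : P → ℕ → T4TermFormat.Booking
  /-- its final scale is the cutoff -/
  K_eq : ∀ p K, (B p K).K = K
  /-- the booked trajectory (generations and their re-linearised sizes) -/
  T : ∀ p K, Trajectory (B p K)

/-- **THE CLASS AT ONE CUTOFF** [shape]: every booked observable-attached term born at scale `j` has size
`≤ A₀·ρ₁^{k−j}·τ^{K−j}` at every scale `k ∈ [j, K]`. [folklore] -/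
def ClassAt (Bk : T4TermFormat.Booking) (A₀ ρ₁ τ : ℝ) : Prop :=
  Bk.SizeBound (twoRate A₀ ρ₁ τ Bk.K)

/-- **THE ROW ROOT WITH ITS CONSTANTS DISPLAYED** [shape]: `A₀, ρ₁, τ ≥ 0`, `τ ≤ 1`, and at EVERY cutoff and EVERY run
parameter the booked observable-attached terms lie in the two-rate class `twoRate A₀ ρ₁ τ K`. [folklore] -/
def DressedStabilityWith {P : Type*} (𝒯 : DressedTower P) (A₀ ρ₁ τ : ℝ) : Prop :=
  0 ≤ A₀ ∧ 0 ≤ ρ₁ ∧ 0 ≤ τ ∧ τ ≤ 1 ∧ ∀ p K, ClassAt (𝒯.B p K) A₀ ρ₁ τ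

/-- **THE ROW ROOT — DRESSED STABILITY OF THE OBSERVABLE-ATTACHED TERMS, UNIFORM IN THE CUTOFF AND IN THE RUN PARAMETER**
[shape] (BINDER-OWNERS row NE1′, RULING R-t4r2-Q2: μ-uniform = the constants precede `∀ p`; K-uniform = they precede `∀ K`):
there are `A₀, ρ₁, τ ≥ 0`, `τ ≤ 1`, such that at EVERY cutoff and EVERY run parameter the booked observable-attached terms lie
in the two-rate class.  NOT PRINTED; NOT PROVED; never asserted — the END faces below conclude it from named binders. [folklore] -/
def DressedStability {P : Type*} (𝒯 : DressedTower P) : Prop :=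
  ∃ A₀ ρ₁ τ : ℝ, DressedStabilityWith 𝒯 A₀ ρ₁ τ

/-- **THE BUDGET COROLLARY** [bookkeeping]: the root with its constants, K-free positional counts `#{births of scale j felt at a
k-cube} ≤ N₀·Λ^{k−j}` ((w3-book); supplier format `T4FeltGeometry.positionalCount_of_anchoring`) and the product condition
`Λ·ρ₁·τ ≤ 1` give, for every cutoff, every run parameter and every nonnegative weight profile of total `≤ W`, the per-cube budget
`(N₀·A₀)·W` — (TOB-k) with a K-FREE constant (`Booking.cubeBudget_of_twoRate` by name): the smallness the (2.18)-type consumers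
(rows O3.E-iii-c, U5b.E, O4) quantify over. [folklore] -/
theorem cubeBudget_of_dressedStabilityWith {P : Type*} {𝒯 : DressedTower P} {A₀ ρ₁ τ N₀ Λ : ℝ}
    (h : DressedStabilityWith 𝒯 A₀ ρ₁ τ) (hN₀ : 0 ≤ N₀) (hΛ : 0 ≤ Λ) (hprod : Λ * ρ₁ * τ ≤ 1)
    (hcount : ∀ p K, (𝒯.B p K).PositionalCount fun j k => N₀ * Λ ^ (k - j))
    (p : P) (K : ℕ) {w : ℕ → ℝ} {W : ℝ} (hw : ∀ j ≤ K, 0 ≤ w j) (hW : ∑ j ∈ range (K + 1), w j ≤ W) :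
    (𝒯.B p K).CubeBudget w (N₀ * A₀ * W) := by
  obtain ⟨hA₀, hρ₁, hτ0, hτ1, hcl⟩ := h
  have hK := 𝒯.K_eq p K
  exact cubeBudget_of_twoRate (N := fun j k => N₀ * Λ ^ (k - j)) (σ := twoRate A₀ ρ₁ τ (𝒯.B p K).K)
    (by rw [hK]; exact hw) (by rw [hK]; exact hW) (hcount p K) (hcl p K)
    (fun j k => twoRate_nonneg hA₀ hρ₁ hτ0 _ j k) hN₀ hA₀ hΛ hρ₁ hτ0 hτ1 hprod (fun j k _ _ => le_rfl)
    (fun j k _ _ => le_rfl)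

/-- **CONSUMER FACE** [bookkeeping]: the root unfolds, per cutoff and run parameter, to `Booking.SizeBound` by the two-rate class —
the size-bound currency in which rows O3.E-iii-c (`T4PreservedUnderR`), O3.E-iii-a and U5b.E read the class. [folklore] -/
theorem sizeBound_of_dressedStabilityWith {P : Type*} {𝒯 : DressedTower P} {A₀ ρ₁ τ : ℝ}
    (h : DressedStabilityWith 𝒯 A₀ ρ₁ τ) (p : P) (K : ℕ) :
    (𝒯.B p K).SizeBound (twoRate A₀ ρ₁ τ (𝒯.B p K).K) :=
  h.2.2.2.2 p K

/-! ## §3 END-B (booking level): uniform constants, the leaf binders per cutoff, and the root from them -/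

/-- **THE K- AND μ-FREE CONSTANTS OF THE DRESSED FORMAT** [data] with their sign ∕ strictness constraints: `C` the transport
constant (`4c_δ/r` of the birth chart), `A₀` the class amplitude, `ρ₁` the family factor, `τ` the source decay, `Λ`/`N₀` the
positional count rate ∕ multiplicity, `ρ′ < 1` with the STRICT PRODUCT `Λ·ρ₁·τ ≤ ρ′` ((w7), O-G2), `s̄⁰` the per-step ACTION
oscillation margin ((w2-act)), `m ≥ 0` the source-strength factor of the dressed budget with the K-FREE SMALLNESS
`m·N₀A₀(1−ρ′)⁻¹ ≤ 1 − s̄⁰` ((w6), the `|μ| ≤ μ₀` window).  Numbers and inequalities; NOT asserted for Bałaban's scheme. [folklore] -/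
structure UniformConstants where
  /-- transport constant -/
  C : ℝ
  /-- class amplitude -/
  A₀ : ℝ
  /-- per-step family factor -/
  ρ₁ : ℝ
  /-- source decay per scale -/
  τ : ℝ
  /-- positional count rate -/
  Λ : ℝ
  /-- positional count multiplicity -/
  N₀ : ℝ
  /-- strict-product bound -/
  ρ' : ℝ
  /-- per-step action oscillation margin -/
  sbar : ℝ
  /-- source-strength factor of the dressed budget -/
  m : ℝ
  hC : 0 ≤ C
  hA₀ : 0 ≤ A₀
  hρ₁ : 0 ≤ ρ₁
  hτ0 : 0 ≤ τ
  hτ1 : τ ≤ 1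
  hΛ : 0 ≤ Λ
  hN₀ : 0 ≤ N₀
  hm : 0 ≤ m
  /-- (w7) strict product -/
  hρ'1 : ρ' < 1
  hprod : Λ * ρ₁ * τ ≤ ρ'
  /-- (w6) K-free smallness of the source -/
  hsmall : m * (N₀ * A₀ * (1 - ρ')⁻¹) ≤ 1 - sbar

/-- **THE LEAF BINDERS AT ONE CUTOFF** [data + hypothesis shapes] over a booking `Bk` with its booked trajectory `T`: the run's
per-step rates `ρ`, regeneration constants `c`, per-family action margins `s⁰`, and per met component the finset `S k b` of its
live families, WITH the binders of `T4TrajectoryDensityDressed.dressedBudget_closed` labelled by wall item of the record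
`t4/T4-EST-NE1p-P1.md` §4 — (w7) `hrate` (family factor under the uniform `ρ₁`), (w3-book) `hS`/`hcount` (positional count of the
live families in a met component), (w2-act) `hs₀` (action margin `≤ s̄⁰`), (w1)+(w5b) `hbirth` (history-sourced births:
`BirthsFromOld`, supplied by `birthsFromOld_of_diag` from `BirthGen` or by `birthsFromOld_of_absorbsFrom` from the absorption
format), T `htr` (gated variable-rate transport — THE TRANSPORT LEAF, discharged at function level by §4), (w5)∕O-G2 `hreg`
(gated regeneration).  The gate is the dressed budget `budgetGate T s⁰ m S C ρ` itself.  NOT asserted for the cell's terms. [folklore] -/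
structure BookingLeaves (U : UniformConstants) (Bk : T4TermFormat.Booking) (T : Trajectory Bk) where
  /-- per-step transport rates `ψ·α_i` -/
  ρ : ℕ → ℝ
  /-- per-step regeneration constants -/
  c : ℕ → ℝ
  /-- per-family, per-step action oscillation margins -/
  s₀ : Bk.Birth → ℕ → ℝ
  /-- live families of the met component of `b` at step `k` -/
  S : ℕ → Bk.Birth → Finset Bk.Birth
  hρ : ∀ k, 0 ≤ ρ k
  hc : ∀ k, 0 ≤ c k
  /-- (w7) the family factor is below the uniform `ρ₁` -/
  hrate : ∀ k, k < Bk.K → ρ k + U.C * c k ≤ U.ρ₁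
  /-- (w3-book) live families are born -/
  hS : ∀ k b, ∀ f ∈ S k b, Bk.birthScale f ≤ k
  /-- (w3-book) positional count of the live families per birth scale -/
  hcount : ∀ k b, ∀ j ≤ k, (((S k b).filter fun f => Bk.birthScale f = j).card : ℝ) ≤ U.N₀ * U.Λ ^ (k - j)
  /-- (w2-act) per-step action margin -/
  hs₀ : ∀ b k, s₀ b k ≤ U.sbar
  /-- (w1)+(w5b) history-sourced births in the uniform class -/
  hbirth : T.BirthsFromOld U.C ρ (twoRate U.A₀ U.ρ₁ U.τ Bk.K) (budgetGate T s₀ U.m S U.C ρ)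
  /-- T: gated variable-rate transport (END-F) -/
  htr : T.TransportsFromVar U.C ρ (budgetGate T s₀ U.m S U.C ρ)
  /-- (w5)∕O-G2: gated regeneration -/
  hreg : T.RegeneratesFromVar c (budgetGate T s₀ U.m S U.C ρ)

/-- **ONE CUTOFF** [bookkeeping]: the leaf binders give the class at this cutoff AND every dressed budget gate along the
trajectory — `dressedBudget_closed` (envelope bound + `RanBelow (budgetGate …) k` at every `k ≤ K`) followed by
`sizeBoundAt_of_envBoundAtVar` (actual size ≤ envelope under the transport leaf and the history). [folklore] -/
theorem classAt_of_bookingLeaves {U : UniformConstants} {Bk : T4TermFormat.Booking} {T : Trajectory Bk}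
    (L : BookingLeaves U Bk T) :
    ClassAt Bk U.A₀ U.ρ₁ U.τ ∧ ∀ k, k ≤ Bk.K → RanBelow (budgetGate T L.s₀ U.m L.S U.C L.ρ) k := by
  have h := dressedBudget_closed (σ := twoRate U.A₀ U.ρ₁ U.τ Bk.K) U.hC L.hρ L.hc U.hm U.hA₀ U.hρ₁ U.hτ0 U.hτ1 U.hΛ
    U.hN₀ U.hρ'1 U.hprod L.hS L.hcount (fun j k _ _ => le_of_eq rfl) L.hs₀ U.hsmall L.hbirth
    (twoRate_compat U.hA₀ U.hρ₁ U.hτ0 Bk.K L.hrate) L.htr L.hreg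
  exact ⟨sizeBound_iff.mpr fun k hk => Trajectory.sizeBoundAt_of_envBoundAtVar L.htr hk (h k hk).2 (h k hk).1,
    fun k hk => (h k hk).2⟩

/-- **END-B — THE ROOT FROM THE LEAF BINDERS WITH UNIFORM CONSTANTS** [bookkeeping]: if ONE `U : UniformConstants` serves the
leaf binders at EVERY cutoff and EVERY run parameter, the dressed tower has `DressedStabilityWith 𝒯 U.A₀ U.ρ₁ U.τ` — hence
`DressedStability 𝒯`.  The order of quantifiers is the content: `U` precedes `p` and `K`. [folklore] -/
theorem dressedStabilityWith_of_bookingLeaves {P : Type*} (U : UniformConstants) (𝒯 : DressedTower P)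
    (L : ∀ p K, BookingLeaves U (𝒯.B p K) (𝒯.T p K)) : DressedStabilityWith 𝒯 U.A₀ U.ρ₁ U.τ :=
  ⟨U.hA₀, U.hρ₁, U.hτ0, U.hτ1, fun p K => (classAt_of_bookingLeaves (L p K)).1⟩

/-- **END-B, existential form** [bookkeeping]. [folklore] -/
theorem dressedStability_of_bookingLeaves {P : Type*} (U : UniformConstants) (𝒯 : DressedTower P)
    (L : ∀ p K, BookingLeaves U (𝒯.B p K) (𝒯.T p K)) : DressedStability 𝒯 :=
  ⟨U.A₀, U.ρ₁, U.τ, dressedStabilityWith_of_bookingLeaves U 𝒯 L⟩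

/-- **END-B + the budget** [bookkeeping]: with the bookings' positional counts `N₀Λ^{k−j}` (the same `U`) every cube of every
cutoff carries the budget `(N₀A₀)·W` (the strict product gives `Λρ₁τ ≤ ρ′ < 1 ≤ 1`). [folklore] -/
theorem cubeBudget_of_bookingLeaves {P : Type*} (U : UniformConstants) (𝒯 : DressedTower P)
    (L : ∀ p K, BookingLeaves U (𝒯.B p K) (𝒯.T p K))
    (hcount : ∀ p K, (𝒯.B p K).PositionalCount fun j k => U.N₀ * U.Λ ^ (k - j))
    (p : P) (K : ℕ) {w : ℕ → ℝ} {W : ℝ} (hw : ∀ j ≤ K, 0 ≤ w j) (hW : ∑ j ∈ range (K + 1), w j ≤ W) :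
    (𝒯.B p K).CubeBudget w (U.N₀ * U.A₀ * W) :=
  cubeBudget_of_dressedStabilityWith (dressedStabilityWith_of_bookingLeaves U 𝒯 L) U.hN₀ U.hΛ
    (U.hprod.trans U.hρ'1.le) hcount p K hw hW

/-! ## §4 END-F (function level) BY NAME: the transport leaf with the dressed budget as its gate -/

section FunctionLevel

open MeasureTheory Set Metric
open T4BirthChartTransport (GaugeInvariant BirthSlice RelGauge)
open T4BlockTransport (Fld NDir latMove latN)
open T4TrajectoryDensity

variable {B : T4TermFormat.Booking} {T : Trajectory B}
variable {R : Type*} [NormedRing R] [NormedAlgebra ℂ R] [MeasurableSpace R] {d : ℕ}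
  {F : Type*} [NormedAddCommGroup F] [NormedSpace ℂ F] [CompleteSpace F]

/-- **END-F — THE TRANSPORT LEAF `htr` AT FUNCTION LEVEL, GATED BY THE DRESSED BUDGET ITSELF** [bookkeeping]: the lineage's gated
per-family centred capstone `T4TrajectoryDensityDressed.transportsFromVar_of_centredExponent_lattice_fam_gated` with
`Gate := budgetGate T s m S (4c_δ/r) (ψ·α)` and the observable budget share `s₁ b k := m·Σ_{f ∈ S k b} envVar … f k`, whose budget
binder `hs` is then the history itself (`hs_of_budgetGate`) — so it DISAPPEARS.  What stays displayed is the wall of record, per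
met component `(b, k)` of every generation `(b, k′)`: (w1) `hsl` analytic births on the lattice chart (radius `r`, window `w`,
size `gen`); H2 `hFn` the dressed step law through the normalised fluctuation operation `wOp` with weight `base·e^{−(𝒜+𝒬)}` and
`h𝒢` class membership; (w2-act) `hB : RealBaseAt (ref b k)` + `hE : ExponentSliceAt (ref b k)` with margin `s b k` for the ACTION
exponent — printed TYPE [Balaban1989LargeFieldII] (1.65) p. 375 ∕ (1.71)–(1.75) pp. 379–380, asserted for Bałaban's densities
NOWHERE; `hP` the centred perturbation slice of the observable-attached exponent with size `m·Σ envVar` — DISCHARGED under the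
history by `T4TrajectoryDensityAssembly.pertSlice_under_history` + `T4TrajectoryDensityFreshBooking.envelopeResponse_of_booking`
given (I4′) fresh defects and (w3)⁺ cross-family nesting; (w3)⁺ `hN1`/`hN2`/`hdiam`/`hθ` window nesting and fluctuation diameter;
(w4) `hdom : e³·(1 + 4θ/ϱ) ≤ α k`; (I4′) `hdefw`/`hrate` transverse defects `≤ c_δψ^{k−k′}`; attainment `hlin`; invariance `hinv`;
`hDμ` full-measure window.  Conclusion: EXACTLY the field `htr` of `BookingLeaves` with `C = 4c_δ/r`, `ρ i = ψ·α i`. [folklore] -/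
theorem transportLeaf_of_centredExponent {Fn : B.Birth → ℕ → ℕ → Fld d R → F}
    {rel : B.Birth → ℕ → ℕ → Fld d R → Fld d R → Prop} {𝒦 : B.Birth → ℕ → ℕ → Set (Fld d R)}
    {ref : B.Birth → ℕ → Fld d R → Fld d R} {base : B.Birth → ℕ → Fld d R → ℝ}
    {𝒜 𝒬 : B.Birth → ℕ → Fld d R → Fld d R → ℂ} {q : B.Birth → ℕ → Fld d R → ℂ}
    {μ : B.Birth → ℕ → Measure (Fld d R)} {z₀ : B.Birth → ℕ → Fld d R} {D : B.Birth → ℕ → Set (Fld d R)}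
    {defect : B.Birth → ℕ → ℕ → ℝ} {cδ ψ w r m : ℝ} {s θ : B.Birth → ℕ → ℝ} {α : ℕ → ℝ}
    {ϱ : B.Birth → ℕ → ℕ → ℝ} {S : ℕ → B.Birth → Finset B.Birth}
    (hα : ∀ i, 0 ≤ α i) (hr : 0 < r) (hw : 0 < w)
    (hsl : ∀ (b : B.Birth) (k' : ℕ), B.birthScale b ≤ k' → k' ≤ B.K →
      RanBelow (budgetGate T s m S (4 * cδ / r) (fun i => ψ * α i)) k' →
      BirthSlice (Fn b k' k') latMove latN (𝒦 b k' k') w r (T.gen b k'))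
    (hFn : ∀ (b : B.Birth) (k' k : ℕ), B.birthScale b ≤ k' → k' ≤ k → k + 1 ≤ B.K →
      RanBelow (budgetGate T s m S (4 * cδ / r) (fun i => ψ * α i)) (k + 1) →
      ∀ U, Fn b k' (k + 1) U =
        wOp (expWeight (base b k) (𝒜 b k + 𝒬 b k)) (μ b k) (z₀ b k) U (fun z => Fn b k' k (U + z)))
    (h𝒢 : ∀ (b : B.Birth) (k' k : ℕ), B.birthScale b ≤ k' → k' ≤ k → k + 1 ≤ B.K →
      RanBelow (budgetGate T s m S (4 * cδ / r) (fun i => ψ * α i)) (k + 1) →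
      ∀ U, (fun z => Fn b k' k (U + z)) ∈ BddClass F (μ b k))
    (hD : ∀ b k, (D b k).Nonempty) (hϱ : ∀ b k' k, 0 < ϱ b k' k)
    (hB : ∀ (b : B.Birth) (k' k : ℕ), B.birthScale b ≤ k' → k' ≤ k → k + 1 ≤ B.K →
      RanBelow (budgetGate T s m S (4 * cδ / r) (fun i => ψ * α i)) (k + 1) →
      RealBaseAt (ref b k) (base b k) (𝒜 b k) (μ b k) (𝒦 b k' (k + 1)))
    (hE : ∀ (b : B.Birth) (k' k : ℕ), B.birthScale b ≤ k' → k' ≤ k → k + 1 ≤ B.K →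
      RanBelow (budgetGate T s m S (4 * cδ / r) (fun i => ψ * α i)) (k + 1) →
      ExponentSliceAt (ref b k) (𝒜 b k) (μ b k) latMove latN (𝒦 b k' (k + 1)) w (ϱ b k' k) (s b k))
    (hP : ∀ (b : B.Birth) (k' k : ℕ), B.birthScale b ≤ k' → k' ≤ k → k + 1 ≤ B.K →
      RanBelow (budgetGate T s m S (4 * cδ / r) (fun i => ψ * α i)) (k + 1) →
      PertSlice (fun U z => 𝒬 b k U z - q b k U) (μ b k) latMove latN (𝒦 b k' (k + 1)) w (ϱ b k' k)
        (m * ∑ f ∈ S k b, T.envVar (4 * cδ / r) (fun i => ψ * α i) f k))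
    (hDμ : ∀ b k, ∀ᵐ z ∂μ b k, z ∈ D b k)
    (hN1 : ∀ (b : B.Birth) (k' k : ℕ), B.birthScale b ≤ k' → k' ≤ k → k + 1 ≤ B.K →
      ∀ z ∈ D b k, ∀ U ∈ 𝒦 b k' (k + 1), U + z ∈ 𝒦 b k' k)
    (hN2 : ∀ (b : B.Birth) (k' k : ℕ), B.birthScale b ≤ k' → k' ≤ k → k + 1 ≤ B.K →
      ∀ U₀ ∈ 𝒦 b k' (k + 1), ∀ p : NDir d R, latN p ≤ w → ∀ z' ∈ D b k, latMove U₀ p 1 + z' ∈ 𝒦 b k' k)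
    (hdiam : ∀ b k, ∀ z ∈ D b k, ∀ z' ∈ D b k, ∀ x ν, ‖z x ν - z' x ν‖ ≤ θ b k)
    (hθ : ∀ b k, 0 < θ b k ∧ θ b k ≤ w)
    (hdom : ∀ (b : B.Birth) (k' k : ℕ), B.birthScale b ≤ k' → k' ≤ k → k + 1 ≤ B.K →
      Real.exp 3 * (1 + 4 * θ b k / ϱ b k' k) ≤ α k)
    (hinv : ∀ b k' k, GaugeInvariant (rel b k' k) (Fn b k' k))
    (hdefw : ∀ b k' k, defect b k' k ≤ w)
    (hrate : ∀ (b : B.Birth) (k' k : ℕ), B.birthScale b ≤ k' → k' ≤ k → k ≤ B.K →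
      defect b k' k ≤ cδ * ψ ^ (k - k'))
    (hlin : ∀ (b : B.Birth) (k' k : ℕ), B.birthScale b ≤ k' → k' ≤ k → k ≤ B.K →
      RanBelow (budgetGate T s m S (4 * cδ / r) (fun i => ψ * α i)) k → ∀ ε > 0,
      ∃ U₀ ∈ 𝒦 b k' k, ∃ U₁ : Fld d R, RelGauge (rel b k' k) latMove latN U₀ U₁ (defect b k' k) ∧
        T.lin b k' k ≤ ‖Fn b k' k U₁ - Fn b k' k U₀‖ + ε) :
    T.TransportsFromVar (4 * cδ / r) (fun i => ψ * α i) (budgetGate T s m S (4 * cδ / r) (fun i => ψ * α i)) :=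
  transportsFromVar_of_centredExponent_lattice_fam_gated
    (Gate := budgetGate T s m S (4 * cδ / r) (fun i => ψ * α i))
    (s₁ := fun b k => m * ∑ f ∈ S k b, T.envVar (4 * cδ / r) (fun i => ψ * α i) f k)
    hα hr hw hsl hFn h𝒢 hD hϱ hB hE hP (hs_of_budgetGate (T := T)) hDμ hN1 hN2 hdiam hθ hdom hinv hdefw hrate hlin

end FunctionLevel

end Summit.QuantumFields.BalabanUV.T4Continuum.NE1p.DressedRoot

end
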